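import Mathlib
import Summits.ResolutionOfSingularities.ResolutionOfSingularities.Theorems.WildQuotientsWildQuotientResolutionJordanFiveRootChart0
import Summits.ResolutionOfSingularities.ResolutionOfSingularities.Theorems.WildQuotientsWildQuotientResolutionJordanFiveX0ChartTools

/-!
# N4a (`𝔸ⁿ/(J₃ ⊕ J₂)`, `p ≥ 3`): the root chart at the `μ₂`-vertex — slice conjugation and the fixed ring

(crux stmt-ResolutionOfSingularities-15640 `WildQuotients.WildQuotientResolution`, line `Sketch`;
post-V5 width target N4a `JordanThreeTwo.jordanThreeTwo_hasResolution` of res-L1-w45c-idea-2's card N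
(`passenger-several-blocks`, Sketch v10.1 §Card N; res-L1-w45c-tri-2 `cardNO/CARDS-NO-READ.md` §N;
res-L1-w45c-plan-1 R-LANE RULING 2026-08-27T14:12:52Z (2) / NAMING 14:21:07Z; prover
res-L1-w45c-stub-2, SIG 14:24:14Z, file R1 of the plan). [OURS · L1 W4.5c] — NOT a statement of any
manuscript; replaces the role of no printed item. Def-free; the J₃ ⊕ J₂ twin of res-type-036's
`…JordanFiveRootChart0` (p523699).)

SETTING. `σ = J₃ ⊕ J₂` on `k[x]`: `x_b ↦ x_b + x_a`, `x_c ↦ x_c + x_b`, `x_e ↦ x_e + x_d`, the other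
variables (among them `x_a, x_d`) fixed. Depth weights `(2,1,0 | 1,0)`: on the ROOT CHART of the
`x_a`-vertex of the `(2,1,1)`-weighted blow-up of `V(x_a, x_b, x_d)` (`x_a = u²`, `x_b = ub`, `x_d = uf`,
slots `u = X a`, `b = X b`, `f = X d`) the lifted action is `σ_U : b ↦ b + u`, `x_c ↦ x_c + ub`,
`x_e ↦ x_e + uf`, rest fixed — given ABSTRACTLY by this law.

* `rootChart32_Z_invariant` — the slid passenger `Z₁ = x_e − b·f` is invariant (with
  `ToricExit.rootChart4_artinSchreier` `N = b^p − u^{p−1}b` and `ToricExit.rootChart4_gamma_invariant`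
  `γ₂″ = 2x_c − b² + ub`);
* `rootChart32_conj` — the slice substitution `ψ : x_c ↦ γ₂″, x_e ↦ Z₁` intertwines the pure
  translation `τ : b ↦ b + u` with `σ_U`; `rootChart32_subst_surjective` — `ψ` is onto (`2 ∈ kˣ`);
* `mem_adjoin_of_rootChart32_eq`, **`rootChart32_fixedPoints_eq`** (`p` prime, `p ≥ 3 = char k`): the
  fixed ring of `σ_U` IS `k[N, γ₂″, Z₁, xᵢ (i ∉ {b, c, e})]` (B1 `ToricExit.mem_adjoin_of_translate_eq`
  transported along `ψ`).
-/

-- single-problem summit: the doubled namespace component `ResolutionOfSingularities` is forced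
set_option linter.dupNamespace false

noncomputable section

open MvPolynomial

namespace Summit.ResolutionOfSingularities.ResolutionOfSingularities.Theorems.WildQuotientResolution.JordanThreeTwo

section Invariant

variable {R : Type*} [CommRing R] {n : ℕ} (σU : MvPolynomial (Fin n) R →+* MvPolynomial (Fin n) R)
  (a b d e : Fin n) (ha : σU (X a) = X a) (hb : σU (X b) = X b + X a) (hd : σU (X d) = X d)
  (he : σU (X e) = X e + X a * X d)

include hb hd he in
/-- **The slid passenger `Z₁ = x_e − b f` is invariant** under `b ↦ b + u`, `x_e ↦ x_e + uf`
(`u = X a`, `b = X b`, `f = X d` fixed). [OURS · L1 W4.5c] [folklore] -/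
theorem rootChart32_Z_invariant : σU (X e - X b * X d) = X e - X b * X d := by
  rw [map_sub, map_mul, he, hb, hd]
  ring

end Invariant

variable (k : Type) [Field k] (n : ℕ)
  (σU : MvPolynomial (Fin n) k ≃ₐ[k] MvPolynomial (Fin n) k) (a b c d e : Fin n)
  (hab : a ≠ b) (hac : a ≠ c) (had : a ≠ d) (hae : a ≠ e) (hbc : b ≠ c) (hbd : b ≠ d)
  (hbe : b ≠ e) (hcd : c ≠ d) (hce : c ≠ e) (hde : d ≠ e)
  (hb : σU (X b) = X b + X a) (hc : σU (X c) = X c + X a * X b) (he : σU (X e) = X e + X a * X d)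
  (hσ : ∀ i, i ≠ b → i ≠ c → i ≠ e → σU (X i) = X i)

include hab hac hae hbc hbe hbd hcd hde hb hc he hσ in
/-- **The conjugation.** For any substitution datum `g` with `g c = γ₂″ = 2x_c − b² + ub`,
`g e = Z₁ = x_e − b f` and `g i = xᵢ` otherwise, `ψ = aeval g` intertwines the pure translation
`τ : b ↦ b + u` with `σ_U`: `ψ (τ y) = σ_U (ψ y)`. [OURS · L1 W4.5c] [folklore] -/
theorem rootChart32_conj (g : Fin n → MvPolynomial (Fin n) k)
    (hgc : g c = 2 * X c - X b ^ 2 + X a * X b) (hge : g e = X e - X b * X d)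
    (hgi : ∀ i, i ≠ c → i ≠ e → g i = X i) (y : MvPolynomial (Fin n) k) :
    aeval g (aeval (fun i : Fin n => if i = b then X b + X a else (X i : MvPolynomial (Fin n) k))
      y) = σU (aeval g y) := by
  classical
  set ψ : MvPolynomial (Fin n) k →ₐ[k] MvPolynomial (Fin n) k := aeval g with hψ
  set τ : MvPolynomial (Fin n) k →ₐ[k] MvPolynomial (Fin n) k :=
    aeval (fun i : Fin n => if i = b then X b + X a else (X i : MvPolynomial (Fin n) k)) with hτ
  have ha : σU (X a) = X a := hσ a hab hac hae
  have hd : σU (X d) = X d := hσ d hbd.symm hcd.symm hde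
  have hψX : ∀ i, ψ (X i) = g i := fun i => aeval_X g i
  have hψa : ψ (X a) = X a := (hψX a).trans (hgi a hac hae)
  have hψb : ψ (X b) = X b := (hψX b).trans (hgi b hbc hbe)
  have hτX : ∀ i, τ (X i) = if i = b then X b + X a else X i := fun i => aeval_X _ i
  have key : ψ.comp τ =
      (σU : MvPolynomial (Fin n) k →ₐ[k] MvPolynomial (Fin n) k).comp ψ := by
    refine MvPolynomial.algHom_ext fun i => ?_
    change ψ (τ (X i)) = σU (ψ (X i))
    rw [hτX]
    by_cases hib : i = b
    · rw [if_pos hib, hib, map_add, hψa, hψb, hb]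
    · rw [if_neg hib, hψX]
      by_cases hic : i = c
      · rw [hic, hgc]
        exact (ToricExit.rootChart4_gamma_invariant
          (σU : MvPolynomial (Fin n) k →+* MvPolynomial (Fin n) k) a b c ha hb hc).symm
      · by_cases hie : i = e
        · rw [hie, hge]
          exact (rootChart32_Z_invariant
            (σU : MvPolynomial (Fin n) k →+* MvPolynomial (Fin n) k) a b d e hb hd he).symm
        · rw [hgi i hic hie, hσ i hib hic hie]
  exact congrArg (fun φ : MvPolynomial (Fin n) k →ₐ[k] MvPolynomial (Fin n) k => φ y) key

include hac hae hbc hbe hcd hde in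
/-- **The slice substitution is onto** (`2 ∈ kˣ`): `x_c = ψ(½(x_c + b² − ub))`, `x_e = ψ(x_e + b f)`.
[OURS · L1 W4.5c] [folklore] -/
theorem rootChart32_subst_surjective (h2 : (2 : k) ≠ 0) (g : Fin n → MvPolynomial (Fin n) k)
    (hgc : g c = 2 * X c - X b ^ 2 + X a * X b) (hge : g e = X e - X b * X d)
    (hgi : ∀ i, i ≠ c → i ≠ e → g i = X i) :
    Function.Surjective (aeval g : MvPolynomial (Fin n) k →ₐ[k] MvPolynomial (Fin n) k) := by
  classical
  set ψ : MvPolynomial (Fin n) k →ₐ[k] MvPolynomial (Fin n) k := aeval g with hψ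
  have h2C : (2 : MvPolynomial (Fin n) k) * C (2⁻¹ : k) = 1 := JordanFour.two_mul_C_inv_two k n h2
  have hψX : ∀ i, ψ (X i) = g i := fun i => aeval_X g i
  have hψa : ψ (X a) = X a := (hψX a).trans (hgi a hac hae)
  have hψb : ψ (X b) = X b := (hψX b).trans (hgi b hbc hbe)
  have hψd : ψ (X d) = X d := (hψX d).trans (hgi d hcd.symm hde)
  have hψc : ψ (X c) = 2 * X c - X b ^ 2 + X a * X b := (hψX c).trans hgc
  have hψe : ψ (X e) = X e - X b * X d := (hψX e).trans hge
  have hψC : ∀ r : k, ψ (C r) = C r := fun r => ψ.commutes r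
  have hXc : ψ (C (2⁻¹ : k) * (X c + X b ^ 2 - X a * X b)) = X c := by
    simp only [map_mul, map_sub, map_add, map_pow, hψC, hψa, hψb, hψc]
    linear_combination (X c : MvPolynomial (Fin n) k) * h2C
  have hXe : ψ (X e + X b * X d) = X e := by
    rw [map_add, map_mul, hψe, hψb, hψd]; ring
  refine JordanFive.surjective_of_forall_X ψ fun i => ?_
  by_cases hic : i = c
  · exact ⟨_, hXc.trans (by rw [hic])⟩
  · by_cases hie : i = e
    · exact ⟨_, hXe.trans (by rw [hie])⟩
    · exact ⟨X i, (hψX i).trans (hgi i hic hie)⟩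

include hab hac hae hbc hbd hbe hcd hce hde hb hc he hσ in
/-- **Fixed points of the root-chart action lie in `k[N, γ₂″, Z₁, xᵢ (i ∉ {b,c,e})]`** (`p` prime,
`p ≥ 3 = char k`), `N = b^p − u^{p−1}b`: conjugate `σ_U` to the pure translation by `ψ`
(`rootChart32_conj`; `ψ` is an automorphism) and apply B1 `ToricExit.mem_adjoin_of_translate_eq`.
[OURS · L1 W4.5c] -/
theorem mem_adjoin_of_rootChart32_eq (p : ℕ) (hp : p.Prime) (hp3 : 3 ≤ p) [CharP k p]
    (f : MvPolynomial (Fin n) k) (hf : σU f = f) :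
    f ∈ Algebra.adjoin k (({X b ^ p - X a ^ (p - 1) * X b, 2 * X c - X b ^ 2 + X a * X b,
        X e - X b * X d} : Set (MvPolynomial (Fin n) k)) ∪
      ((fun i => X i) '' {i | i ≠ b ∧ i ≠ c ∧ i ≠ e})) := by
  classical
  have h2 : (2 : k) ≠ 0 := by
    intro h
    have hdvd : p ∣ 2 := (CharP.cast_eq_zero_iff k p 2).mp (by exact_mod_cast h)
    have := Nat.le_of_dvd two_pos hdvd
    omega
  set N : MvPolynomial (Fin n) k := X b ^ p - X a ^ (p - 1) * X b with hN
  set γ2 : MvPolynomial (Fin n) k := 2 * X c - X b ^ 2 + X a * X b with hγ2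
  set Z1 : MvPolynomial (Fin n) k := X e - X b * X d with hZ1
  set T := Algebra.adjoin k (({N, γ2, Z1} : Set (MvPolynomial (Fin n) k)) ∪
      ((fun i => X i) '' {i | i ≠ b ∧ i ≠ c ∧ i ≠ e})) with hT
  let g : Fin n → MvPolynomial (Fin n) k := fun i => if i = c then γ2 else if i = e then Z1 else X i
  have hgc : g c = γ2 := if_pos rfl
  have hge : g e = Z1 := by
    change (if e = c then γ2 else if e = e then Z1 else X e) = Z1
    rw [if_neg (Ne.symm hce), if_pos rfl]
  have hgi : ∀ i, i ≠ c → i ≠ e → g i = X i := by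
    intro i hic hie
    change (if i = c then γ2 else if i = e then Z1 else X i) = X i
    rw [if_neg hic, if_neg hie]
  set ψ : MvPolynomial (Fin n) k →ₐ[k] MvPolynomial (Fin n) k := aeval g with hψ
  have hψX : ∀ i, ψ (X i) = g i := fun i => aeval_X g i
  have hψa : ψ (X a) = X a := (hψX a).trans (hgi a hac hae)
  have hψb : ψ (X b) = X b := (hψX b).trans (hgi b hbc hbe)
  have hsurj : Function.Surjective ψ :=
    rootChart32_subst_surjective k n a b c d e hac hae hbc hbe hcd hde h2 g hgc hge hgi
  have hinj : Function.Injective ψ := ToricExit.algHom_injective_of_surjective k n ψ hsurj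
  obtain ⟨q, rfl⟩ := hsurj f
  have hτq : aeval (fun i : Fin n => if i = b then X b + X a else (X i : MvPolynomial (Fin n) k))
      q = q := by
    apply hinj
    rw [hψ, rootChart32_conj k n σU a b c d e hab hac hae hbc hbd hbe hcd hde hb hc he hσ g hgc
      hge hgi q]
    exact hf
  have hq : q ∈ Algebra.adjoin k (({X b ^ p - X a ^ (p - 1) * X b} :
      Set (MvPolynomial (Fin n) k)) ∪ ((fun i => X i) '' {i | i ≠ b})) :=
    ToricExit.mem_adjoin_of_translate_eq k n a b hab p hp q hτq
  have hmap : Subalgebra.map ψ (Algebra.adjoin k (({X b ^ p - X a ^ (p - 1) * X b} :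
      Set (MvPolynomial (Fin n) k)) ∪ ((fun i => X i) '' {i | i ≠ b}))) ≤ T := by
    rw [AlgHom.map_adjoin, hT]
    refine Algebra.adjoin_le ?_
    rintro _ ⟨y, hy, rfl⟩
    rcases hy with hy | ⟨i, hib, rfl⟩
    · rw [Set.mem_singleton_iff] at hy
      subst hy
      rw [map_sub, map_pow, map_mul, map_pow, hψb, hψa]
      exact Algebra.subset_adjoin (Or.inl (Set.mem_insert _ _))
    · change ψ (X i) ∈ _
      by_cases hic : i = c
      · subst hic
        rw [hψX, hgc]
        exact Algebra.subset_adjoin (Or.inl (Set.mem_insert_of_mem _ (Set.mem_insert _ _)))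
      · by_cases hie : i = e
        · subst hie
          rw [hψX, hge]
          exact Algebra.subset_adjoin (Or.inl
            (Set.mem_insert_of_mem _ (Set.mem_insert_of_mem _ (Set.mem_singleton _))))
        · rw [hψX, hgi i hic hie]
          exact Algebra.subset_adjoin (Or.inr ⟨i, ⟨hib, hic, hie⟩, rfl⟩)
  exact hmap (Subalgebra.mem_map.mpr ⟨q, hq, rfl⟩)

include hab hac hae hbc hbd hbe hcd hce hde hb hc he hσ in
/-- **The fixed ring of the root-chart action IS `k[N, γ₂″, Z₁, xᵢ (i ∉ {b,c,e})]`** (`p` prime,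
`p ≥ 3 = char k`): `⊆` is `mem_adjoin_of_rootChart32_eq`; `⊇` because the generators are fixed.
[OURS · L1 W4.5c] -/
theorem rootChart32_fixedPoints_eq (p : ℕ) (hp : p.Prime) (hp3 : 3 ≤ p) [CharP k p] :
    {f : MvPolynomial (Fin n) k | σU f = f} =
      ↑(Algebra.adjoin k (({X b ^ p - X a ^ (p - 1) * X b, 2 * X c - X b ^ 2 + X a * X b,
          X e - X b * X d} : Set (MvPolynomial (Fin n) k)) ∪
        ((fun i => X i) '' {i | i ≠ b ∧ i ≠ c ∧ i ≠ e}))) := by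
  classical
  haveI : Fact p.Prime := ⟨hp⟩
  have ha : σU (X a) = X a := hσ a hab hac hae
  have hd : σU (X d) = X d := hσ d hbd.symm hcd.symm hde
  refine Set.Subset.antisymm (fun f hf => ?_) (fun f hf => ?_)
  · exact mem_adjoin_of_rootChart32_eq k n σU a b c d e hab hac hae hbc hbd hbe hcd hce hde
      hb hc he hσ p hp hp3 f hf
  · have hle : Algebra.adjoin k (({X b ^ p - X a ^ (p - 1) * X b, 2 * X c - X b ^ 2 + X a * X b,
          X e - X b * X d} : Set (MvPolynomial (Fin n) k)) ∪
        ((fun i => X i) '' {i | i ≠ b ∧ i ≠ c ∧ i ≠ e})) ≤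
        AlgHom.equalizer (σU : MvPolynomial (Fin n) k →ₐ[k] MvPolynomial (Fin n) k)
          (AlgHom.id k (MvPolynomial (Fin n) k)) := by
      refine Algebra.adjoin_le ?_
      rintro y (hy | ⟨i, ⟨hib, hic, hie⟩, rfl⟩)
      · rw [SetLike.mem_coe, AlgHom.mem_equalizer]
        change σU y = y
        rcases hy with rfl | rfl | hy
        · exact ToricExit.rootChart4_artinSchreier
            (σU : MvPolynomial (Fin n) k →+* MvPolynomial (Fin n) k) a b ha hb p
        · exact ToricExit.rootChart4_gamma_invariant
            (σU : MvPolynomial (Fin n) k →+* MvPolynomial (Fin n) k) a b c ha hb hc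
        · rw [Set.mem_singleton_iff] at hy
          subst hy
          exact rootChart32_Z_invariant
            (σU : MvPolynomial (Fin n) k →+* MvPolynomial (Fin n) k) a b d e hb hd he
      · rw [SetLike.mem_coe, AlgHom.mem_equalizer]
        exact hσ i hib hic hie
    exact (AlgHom.mem_equalizer _ _ f).mp (hle hf)

end Summit.ResolutionOfSingularities.ResolutionOfSingularities.Theorems.WildQuotientResolution.JordanThreeTwo

end
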